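import Summits.ValiantsHypothesis.ValiantsHypothesis.Theorems.KPlusLogSqLawWeakLiftingTowerGraftTwoSidedLoewner
import Summits.ValiantsHypothesis.ValiantsHypothesis.Theorems.KPlusLogSqLawWeakLiftingTowerGraftTwoSidedThreeLettersKernels

/-!
# Tower graft line — two-sided words: THE TWO-GAP CERTIFICATE THEOREM (reduced pencil `A + s^e J + s^{e+f} B`, every `e, f ≥ 1`)

Crux `stmt-ValiantsHypothesis-19561` (`WeakLifting`), line (B) `tower_graft`, two-sided word instrument; seat val-sym-lift-p3 g21,
`--supports 19561`, NO stub claimed.  Part C (`…TwoSidedThreeLettersKernels`, g20) typed the rank law of the three-letter word for the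
reduced pencil `A + s J + s^{n+1} B` (lower gap DIVIDES the upper gap) modulo an abstract Loewner certificate, with instances
`n = 1, 2, 4`.  This file types the GENERAL reduced pencil `A + s^e J + s^{e+f} B` (ANY two gaps `e, f ≥ 1`, i.e. every support
`a < b < c` after division by `X^a`) for FAMILIES of kernel pairs whose scales may REPEAT (same-scale pairs polarised, as in parts D/E′/I):
* `card_posType_le_rank_of_certificate_two_gaps`: `A, B ⪰ 0`, `J` symmetric, positive-type pairs (`e⟨u,Au⟩ < f s^{e+f}⟨u,Bu⟩`) number
  at most `rank B` given a PSD certificate with `N_{ik}·(f sₖ^{e+f}) = e` (`sᵢ = sₖ`) and `N_{ik}·(sᵢ^e sₖ^e (sᵢ^f − sₖ^f)) = sᵢ^e − sₖ^e`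
  (`sᵢ ≠ sₖ`) — Gram identity `(sᵢ^e − sₖ^e)⟨uᵢ,Auₖ⟩ = sᵢ^e sₖ^e (sᵢ^f − sₖ^f)⟨uᵢ,Buₖ⟩` (`gramA_eq_two_gaps`), `Gram_B = Gram_A ⊙ N + diag(>0)`;
* `card_negType_le_rank_of_certificate_two_gaps`: the mirror (`t ↦ 1/t`): negative-type pairs `≤ rank A`;
* UNCONDITIONAL forms by the Loewner file (`Loewner.exists_certificate_two_gaps_family`, exponent `e/f` resp. `f/e`):
  `card_posType_family_le_rank_two_gaps` (`e ≤ f`), `card_negType_family_le_rank_two_gaps` (`f ≤ e`), the distinct-scale corollaries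
  `card_posType_le_rank_two_gaps` / `card_negType_le_rank_two_gaps`, and part C's own law at EVERY gap `card_posType_le_rank_gap (n ≥ 1)`.
Since `e ≤ f` or `f ≤ e` always holds, ONE of the two rank bounds is available on EVERY three-letter support — the census files
`…TwoSidedAllSupports` / `…AllSupportsDefinite` turn this into `Z₊ ≤ 2m`.  HONEST FRAMING: a structural law for THREE letters (all supports);
nothing on the four-letter TOWER column, S4…S5, `TowerB`, `WeakLifting` in its window, Conjecture B, 18050 or `VP ≠ VNP`.  Def-free.

[folklore] Gram/Loewner certificates; Schur product theorem.
-/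

set_option linter.dupNamespace false
set_option autoImplicit false

namespace Summit.ValiantsHypothesis.ValiantsHypothesis.Theorems.KPlusLogSqLaw.TowerGraft

open Matrix
open scoped BigOperators

namespace TwoSidedThree

/-! ## §1 The abstract TWO-GAP certificate theorem (families; scales may repeat): reduced pencil `A + s^e J + s^{e+f} B` -/

section TwoGaps

variable {m : ℕ} {I : Type} [Fintype I] [DecidableEq I]
variable (A J B : Matrix (Fin m) (Fin m) ℝ) (e f : ℕ) (s : I → ℝ) (u : I → Fin m → ℝ)

omit [Fintype I] [DecidableEq I] in
/-- kernel relation of the reduced two-gap pencil `A + s^e J + s^{e+f} B`, polarised. [folklore] -/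
theorem gram_rel_two_gaps (hA : A.IsSymm) (hJ : J.IsSymm) (hB : B.IsSymm)
    (hker : ∀ i, (A + s i ^ e • J + s i ^ (e + f) • B) *ᵥ u i = 0) (i k : I) :
    u i ⬝ᵥ (A *ᵥ u k) + s i ^ e * (u i ⬝ᵥ (J *ᵥ u k)) + s i ^ (e + f) * (u i ⬝ᵥ (B *ᵥ u k)) = 0 := by
  have h := congrArg (fun w => u k ⬝ᵥ w) (hker i)
  simp only [dotProduct_zero, Matrix.add_mulVec, Matrix.smul_mulVec, dotProduct_add, dotProduct_smul,
    smul_eq_mul] at h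
  rw [form_comm hA (u k) (u i), form_comm hJ (u k) (u i), form_comm hB (u k) (u i)] at h
  linarith

omit [Fintype I] [DecidableEq I] in
/-- **the two-gap Gram identity**: `(sᵢ^e − sₖ^e)·⟨uᵢ,Auₖ⟩ = sᵢ^e sₖ^e (sᵢ^f − sₖ^f)·⟨uᵢ,Buₖ⟩`. [folklore] -/
theorem gramA_eq_two_gaps (hA : A.IsSymm) (hJ : J.IsSymm) (hB : B.IsSymm)
    (hker : ∀ i, (A + s i ^ e • J + s i ^ (e + f) • B) *ᵥ u i = 0) (i k : I) :
    (s i ^ e - s k ^ e) * (u i ⬝ᵥ (A *ᵥ u k))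
      = s i ^ e * s k ^ e * (s i ^ f - s k ^ f) * (u i ⬝ᵥ (B *ᵥ u k)) := by
  have h1 := gram_rel_two_gaps A J B e f s u hA hJ hB hker i k
  have h2 := gram_rel_two_gaps A J B e f s u hA hJ hB hker k i
  rw [form_comm hA (u k) (u i), form_comm hJ (u k) (u i), form_comm hB (u k) (u i)] at h2
  simp only [pow_add] at h1 h2
  linear_combination (-(s k ^ e)) * h1 + (s i ^ e) * h2

/-- **THE TWO-SIDED THREE-LETTER LAW through an abstract TWO-GAP certificate (families of kernel pairs; scales may REPEAT).**
`A, B ⪰ 0`, `J` symmetric, gaps `e, f ≥ 1`; pairs `(sᵢ, uᵢ)` of positive scales and kernel vectors of `A + sᵢ^e J + sᵢ^{e+f} B` of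
POSITIVE type (`e·⟨uᵢ,Auᵢ⟩ < f·sᵢ^{e+f}⟨uᵢ,Buᵢ⟩`, the Rayleigh trinomial INCREASING at its root); for two DIFFERENT pairs at the SAME
scale the polarised relation `f s^{e+f}⟨uᵢ,Buₖ⟩ = e⟨uᵢ,Auₖ⟩` (`hsame`: orthogonality for the form `f s^{e+f} B − e A`, which an
orthogonal kernel basis provides); a positive semidefinite certificate `N` with `N_{ik}·(f sₖ^{e+f}) = e` whenever `sᵢ = sₖ` and
`N_{ik}·(sᵢ^e sₖ^e (sᵢ^f − sₖ^f)) = sᵢ^e − sₖ^e` whenever `sᵢ ≠ sₖ`.  Then `#I ≤ rank B` (`Gram_B = Gram_A ⊙ N + diag(> 0) ≻ 0`).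
Part C's `card_posType_le_rank_of_certificate` / part E′'s `…_family` are the case `e = 1`. [folklore] -/
theorem card_posType_le_rank_of_certificate_two_gaps (hA : A.PosSemidef) (hJ : J.IsSymm) (hB : B.PosSemidef)
    (hs : ∀ i, 0 < s i) (he : 0 < e) (hf : 0 < f)
    (hker : ∀ i, (A + s i ^ e • J + s i ^ (e + f) • B) *ᵥ u i = 0)
    (htype : ∀ i, (e : ℝ) * (u i ⬝ᵥ (A *ᵥ u i)) < f * s i ^ (e + f) * (u i ⬝ᵥ (B *ᵥ u i)))
    (hsame : ∀ i k, i ≠ k → s i = s k → (f : ℝ) * s k ^ (e + f) * (u i ⬝ᵥ (B *ᵥ u k)) = e * (u i ⬝ᵥ (A *ᵥ u k)))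
    (N : Matrix I I ℝ) (hN : N.PosSemidef) (hNsame : ∀ i k, s i = s k → N i k * (f * s k ^ (e + f)) = e)
    (hNoff : ∀ i k, s i ≠ s k → N i k * (s i ^ e * s k ^ e * (s i ^ f - s k ^ f)) = s i ^ e - s k ^ e) :
    Fintype.card I ≤ B.rank := by
  classical
  have hAs : A.IsSymm := by
    have h1 := hA.1; unfold Matrix.IsHermitian at h1
    rwa [Matrix.conjTranspose_eq_transpose_of_trivial] at h1
  have hBs : B.IsSymm := by
    have h1 := hB.1; unfold Matrix.IsHermitian at h1
    rwa [Matrix.conjTranspose_eq_transpose_of_trivial] at h1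
  -- the PSD summand `Gram_A ⊙ N`
  have hGA : (Matrix.of fun i' k' => u i' ⬝ᵥ (A *ᵥ u k')).PosSemidef := posSemidef_gram hA u
  have hH : ((Matrix.of fun i' k' => u i' ⬝ᵥ (A *ᵥ u k')) ⊙ N).PosSemidef := hGA.hadamard hN
  -- the decomposition `Gram_B = Gram_A ⊙ N + Δ`
  set Δ : I → ℝ := fun i => u i ⬝ᵥ (B *ᵥ u i) - (u i ⬝ᵥ (A *ᵥ u i)) * N i i with hΔdef
  have hfs : ∀ i, 0 < (f : ℝ) * s i ^ (e + f) := fun i => by have := hs i; have := hf; positivity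
  have hΔpos : ∀ i, 0 < Δ i := by
    intro i
    have ht := htype i
    have hsi := hfs i
    have hNii : N i i = e / (f * s i ^ (e + f)) := by
      rw [eq_div_iff (ne_of_gt hsi)]
      exact hNsame i i rfl
    show 0 < u i ⬝ᵥ (B *ᵥ u i) - (u i ⬝ᵥ (A *ᵥ u i)) * N i i
    rw [hNii, sub_pos, ← mul_div_assoc, div_lt_iff₀ hsi]
    linarith
  have hdecomp : (Matrix.of fun i' k' => u i' ⬝ᵥ (B *ᵥ u k'))
      = (Matrix.of fun i' k' => u i' ⬝ᵥ (A *ᵥ u k')) ⊙ N + Matrix.diagonal Δ := by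
    ext i k
    rw [Matrix.add_apply, Matrix.hadamard_apply, Matrix.of_apply, Matrix.of_apply]
    by_cases hik : i = k
    · subst hik
      rw [Matrix.diagonal_apply_eq]
      simp only [hΔdef]; ring
    · rw [Matrix.diagonal_apply_ne _ hik, add_zero]
      by_cases hsik : s i = s k
      · -- same scale: the polarised relation `hsame` and `N_{ik} = e/(f s^{e+f})`
        have h1 := hsame i k hik hsik
        have h2 := hNsame i k hsik
        have hsk := hfs k
        have h3 : (u i ⬝ᵥ (B *ᵥ u k)) * ((f : ℝ) * s k ^ (e + f))
            = (u i ⬝ᵥ (A *ᵥ u k)) * N i k * ((f : ℝ) * s k ^ (e + f)) := by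
          rw [mul_assoc (u i ⬝ᵥ (A *ᵥ u k)), h2]; linarith
        exact mul_right_cancel₀ (ne_of_gt hsk) h3
      · have h1 := gramA_eq_two_gaps A J B e f s u hAs hJ hBs hker i k
        have h2 := hNoff i k hsik
        have hne : s i ^ e - s k ^ e ≠ 0 := by
          intro h0
          apply hsik
          exact (pow_left_inj₀ (hs i).le (hs k).le (Nat.pos_iff_ne_zero.mp he)).mp (sub_eq_zero.mp h0)
        have hne' : s i ^ e * s k ^ e * (s i ^ f - s k ^ f) ≠ 0 := by
          intro h0; rw [h0, mul_zero] at h2; exact hne h2.symm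
        have h3 : (u i ⬝ᵥ (B *ᵥ u k)) * (s i ^ e * s k ^ e * (s i ^ f - s k ^ f))
            = (u i ⬝ᵥ (A *ᵥ u k)) * N i k * (s i ^ e * s k ^ e * (s i ^ f - s k ^ f)) := by
          rw [mul_assoc (u i ⬝ᵥ (A *ᵥ u k)), h2]; linarith
        exact mul_right_cancel₀ hne' h3
  -- `Gram_B ≻ 0`
  have hGB : (Matrix.of fun i' k' => u i' ⬝ᵥ (B *ᵥ u k')).PosDef := by
    rw [Matrix.posDef_iff_dotProduct_mulVec]
    refine ⟨(posSemidef_gram hB u).1, fun x hx => ?_⟩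
    rw [hdecomp, Matrix.add_mulVec, dotProduct_add]
    have h1 : 0 ≤ star x ⬝ᵥ (((Matrix.of fun i' k' => u i' ⬝ᵥ (A *ᵥ u k')) ⊙ N) *ᵥ x) :=
      (Matrix.posSemidef_iff_dotProduct_mulVec.mp hH).2 x
    have h2 : 0 < star x ⬝ᵥ (Matrix.diagonal Δ *ᵥ x) := by
      rw [star_trivial]
      simp only [dotProduct, Matrix.mulVec_diagonal]
      obtain ⟨i₀, hi₀⟩ := Function.ne_iff.mp hx
      apply Finset.sum_pos'
      · intro i _
        have := hΔpos i
        nlinarith [sq_nonneg (x i)]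
      · refine ⟨i₀, Finset.mem_univ _, ?_⟩
        have := hΔpos i₀
        have hx0 : 0 < x i₀ ^ 2 := sq_pos_iff.mpr hi₀
        nlinarith
    linarith
  have hrank : (Matrix.of fun i' k' => u i' ⬝ᵥ (B *ᵥ u k')).rank = Fintype.card I := Matrix.rank_of_isUnit _ hGB.isUnit
  rw [← hrank]
  exact rank_gram_le B u

/-- **MIRROR (reflection `t ↦ 1/t`) of the two-gap law, families.**  Same pencil; kernel pairs of NEGATIVE type
(`f·s^{e+f}⟨u,Bu⟩ < e·⟨u,Au⟩`); same-scale pairs polarised as before; certificate for the REVERSED gaps `(f, e)` at the reflected nodes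
`σᵢ = sᵢ⁻¹` (pencil `B + σ^f J + σ^{f+e} A`).  Then `#I ≤ rank A`. [folklore] -/
theorem card_negType_le_rank_of_certificate_two_gaps (hA : A.PosSemidef) (hJ : J.IsSymm) (hB : B.PosSemidef)
    (hs : ∀ i, 0 < s i) (he : 0 < e) (hf : 0 < f)
    (hker : ∀ i, (A + s i ^ e • J + s i ^ (e + f) • B) *ᵥ u i = 0)
    (htype : ∀ i, (f : ℝ) * s i ^ (e + f) * (u i ⬝ᵥ (B *ᵥ u i)) < e * (u i ⬝ᵥ (A *ᵥ u i)))
    (hsame : ∀ i k, i ≠ k → s i = s k → (f : ℝ) * s k ^ (e + f) * (u i ⬝ᵥ (B *ᵥ u k)) = e * (u i ⬝ᵥ (A *ᵥ u k)))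
    (N : Matrix I I ℝ) (hN : N.PosSemidef)
    (hNsame : ∀ i k, (s i)⁻¹ = (s k)⁻¹ → N i k * (e * (s k)⁻¹ ^ (f + e)) = f)
    (hNoff : ∀ i k, (s i)⁻¹ ≠ (s k)⁻¹ →
      N i k * ((s i)⁻¹ ^ f * (s k)⁻¹ ^ f * ((s i)⁻¹ ^ e - (s k)⁻¹ ^ e)) = (s i)⁻¹ ^ f - (s k)⁻¹ ^ f) :
    Fintype.card I ≤ A.rank := by
  refine card_posType_le_rank_of_certificate_two_gaps B J A f e (fun i => (s i)⁻¹) u hB hJ hA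
    (fun i => inv_pos.mpr (hs i)) hf he ?_ ?_ ?_ N hN hNsame hNoff
  · intro i
    have hsi := ne_of_gt (hs i)
    have h := congrArg (fun w => ((s i)⁻¹) ^ (e + f) • w) (hker i)
    simp only [smul_zero] at h
    rw [← h, ← Matrix.smul_mulVec]
    congr 1
    have e1 : (s i)⁻¹ ^ (e + f) * s i ^ e = (s i)⁻¹ ^ f := by
      rw [pow_add, mul_assoc, mul_comm ((s i)⁻¹ ^ f), ← mul_assoc, ← mul_pow, inv_mul_cancel₀ hsi, one_pow, one_mul]
    have e2 : (s i)⁻¹ ^ (e + f) * s i ^ (e + f) = 1 := by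
      rw [← mul_pow, inv_mul_cancel₀ hsi, one_pow]
    rw [smul_add, smul_add, smul_smul, smul_smul, e1, e2, one_smul, Nat.add_comm f e]
    abel
  · intro i
    have hsi := hs i
    have ht := htype i
    have hpow : 0 < (s i)⁻¹ ^ (e + f) := pow_pos (inv_pos.mpr hsi) _
    have h1 : (s i)⁻¹ ^ (e + f) * ((f : ℝ) * s i ^ (e + f) * (u i ⬝ᵥ (B *ᵥ u i)))
        < (s i)⁻¹ ^ (e + f) * (e * (u i ⬝ᵥ (A *ᵥ u i))) := mul_lt_mul_of_pos_left ht hpow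
    have h2 : (s i)⁻¹ ^ (e + f) * s i ^ (e + f) = 1 := by
      rw [inv_pow]; exact inv_mul_cancel₀ (pow_ne_zero _ (ne_of_gt hsi))
    rw [Nat.add_comm f e]
    calc (f : ℝ) * (u i ⬝ᵥ (B *ᵥ u i))
        = (s i)⁻¹ ^ (e + f) * ((f : ℝ) * s i ^ (e + f) * (u i ⬝ᵥ (B *ᵥ u i))) := by
          rw [show (s i)⁻¹ ^ (e + f) * ((f : ℝ) * s i ^ (e + f) * (u i ⬝ᵥ (B *ᵥ u i)))
              = ((s i)⁻¹ ^ (e + f) * s i ^ (e + f)) * ((f : ℝ) * (u i ⬝ᵥ (B *ᵥ u i))) by ring, h2, one_mul]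
      _ < (s i)⁻¹ ^ (e + f) * (e * (u i ⬝ᵥ (A *ᵥ u i))) := h1
      _ = e * (s i)⁻¹ ^ (e + f) * (u i ⬝ᵥ (A *ᵥ u i)) := by ring
  · -- same reflected scale: `e σ^{f+e}⟨uᵢ,Auₖ⟩ = f⟨uᵢ,Buₖ⟩` from `f s^{e+f}⟨uᵢ,Buₖ⟩ = e⟨uᵢ,Auₖ⟩`
    intro i k hik hsik
    have hsk := hs k
    have hsik' : s i = s k := inv_injective hsik
    have h := hsame i k hik hsik'
    have h2 : (s k)⁻¹ ^ (f + e) * s k ^ (e + f) = 1 := by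
      rw [Nat.add_comm f e, inv_pow]; exact inv_mul_cancel₀ (pow_ne_zero _ (ne_of_gt hsk))
    calc (e : ℝ) * (s k)⁻¹ ^ (f + e) * (u i ⬝ᵥ (A *ᵥ u k))
        = (s k)⁻¹ ^ (f + e) * (e * (u i ⬝ᵥ (A *ᵥ u k))) := by ring
      _ = (s k)⁻¹ ^ (f + e) * ((f : ℝ) * s k ^ (e + f) * (u i ⬝ᵥ (B *ᵥ u k))) := by rw [h]
      _ = ((s k)⁻¹ ^ (f + e) * s k ^ (e + f)) * ((f : ℝ) * (u i ⬝ᵥ (B *ᵥ u k))) := by ring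
      _ = f * (u i ⬝ᵥ (B *ᵥ u k)) := by rw [h2, one_mul]

/-- **UNCONDITIONAL two-gap law for FAMILIES, lower gap ≤ upper gap** (`1 ≤ e ≤ f`; scales may repeat, same-scale pairs polarised):
positive-type kernel pairs of `A + s^e J + s^{e+f} B` number at most `rank B` — certificate = Loewner matrix of `y ↦ y^{e/f}`
(`Loewner.exists_certificate_two_gaps_family`). [folklore] -/
theorem card_posType_family_le_rank_two_gaps (hA : A.PosSemidef) (hJ : J.IsSymm) (hB : B.PosSemidef)
    (hs : ∀ i, 0 < s i) (he : 0 < e) (hef : e ≤ f)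
    (hker : ∀ i, (A + s i ^ e • J + s i ^ (e + f) • B) *ᵥ u i = 0)
    (htype : ∀ i, (e : ℝ) * (u i ⬝ᵥ (A *ᵥ u i)) < f * s i ^ (e + f) * (u i ⬝ᵥ (B *ᵥ u i)))
    (hsame : ∀ i k, i ≠ k → s i = s k → (f : ℝ) * s k ^ (e + f) * (u i ⬝ᵥ (B *ᵥ u k)) = e * (u i ⬝ᵥ (A *ᵥ u k))) :
    Fintype.card I ≤ B.rank := by
  obtain ⟨N, hN, hNsame, hNoff⟩ := Loewner.exists_certificate_two_gaps_family (I := I) he hef s hs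
  exact card_posType_le_rank_of_certificate_two_gaps A J B e f s u hA hJ hB hs he (lt_of_lt_of_le he hef) hker htype
    hsame N hN hNsame hNoff

/-- **UNCONDITIONAL mirror law for FAMILIES, upper gap ≤ lower gap** (`1 ≤ f ≤ e`): negative-type kernel pairs of
`A + s^e J + s^{e+f} B` number at most `rank A` (Loewner certificate of `y ↦ y^{f/e}` at the reflected nodes). [folklore] -/
theorem card_negType_family_le_rank_two_gaps (hA : A.PosSemidef) (hJ : J.IsSymm) (hB : B.PosSemidef)
    (hs : ∀ i, 0 < s i) (hf : 0 < f) (hfe : f ≤ e)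
    (hker : ∀ i, (A + s i ^ e • J + s i ^ (e + f) • B) *ᵥ u i = 0)
    (htype : ∀ i, (f : ℝ) * s i ^ (e + f) * (u i ⬝ᵥ (B *ᵥ u i)) < e * (u i ⬝ᵥ (A *ᵥ u i)))
    (hsame : ∀ i k, i ≠ k → s i = s k → (f : ℝ) * s k ^ (e + f) * (u i ⬝ᵥ (B *ᵥ u k)) = e * (u i ⬝ᵥ (A *ᵥ u k))) :
    Fintype.card I ≤ A.rank := by
  obtain ⟨N, hN, hNsame, hNoff⟩ := Loewner.exists_certificate_two_gaps_family (I := I) hf hfe (fun i => (s i)⁻¹)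
    (fun i => inv_pos.mpr (hs i))
  exact card_negType_le_rank_of_certificate_two_gaps A J B e f s u hA hJ hB hs (lt_of_lt_of_le hf hfe) hf hker htype hsame
    N hN hNsame hNoff

/-- **UNCONDITIONAL two-gap law at DISTINCT scales, lower gap ≤ upper gap** (`1 ≤ e ≤ f`): positive-type kernel pairs of
`A + s^e J + s^{e+f} B` number at most `rank B`. [folklore] -/
theorem card_posType_le_rank_two_gaps (hA : A.PosSemidef) (hJ : J.IsSymm) (hB : B.PosSemidef)
    (hs : ∀ i, 0 < s i) (hinj : Function.Injective s) (he : 0 < e) (hef : e ≤ f)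
    (hker : ∀ i, (A + s i ^ e • J + s i ^ (e + f) • B) *ᵥ u i = 0)
    (htype : ∀ i, (e : ℝ) * (u i ⬝ᵥ (A *ᵥ u i)) < f * s i ^ (e + f) * (u i ⬝ᵥ (B *ᵥ u i))) :
    Fintype.card I ≤ B.rank :=
  card_posType_family_le_rank_two_gaps A J B e f s u hA hJ hB hs he hef hker htype
    (fun _ _ hik hsik => absurd (hinj hsik) hik)

/-- **UNCONDITIONAL mirror law at DISTINCT scales, upper gap ≤ lower gap** (`1 ≤ f ≤ e`): negative-type kernel pairs of
`A + s^e J + s^{e+f} B` number at most `rank A`. [folklore] -/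
theorem card_negType_le_rank_two_gaps (hA : A.PosSemidef) (hJ : J.IsSymm) (hB : B.PosSemidef)
    (hs : ∀ i, 0 < s i) (hinj : Function.Injective s) (hf : 0 < f) (hfe : f ≤ e)
    (hker : ∀ i, (A + s i ^ e • J + s i ^ (e + f) • B) *ᵥ u i = 0)
    (htype : ∀ i, (f : ℝ) * s i ^ (e + f) * (u i ⬝ᵥ (B *ᵥ u i)) < e * (u i ⬝ᵥ (A *ᵥ u i))) :
    Fintype.card I ≤ A.rank :=
  card_negType_family_le_rank_two_gaps A J B e f s u hA hJ hB hs hf hfe hker htype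
    (fun _ _ hik hsik => absurd (hinj hsik) hik)

/-- **part C's abstract law made unconditional at EVERY gap `n ≥ 1`** (pencil `A + s J + s^{n+1} B`, supports `(d, d+e, d+(n+1)e)`,
distinct scales): positive-type kernel pairs number at most `rank B`; `n = 3` (the 3-tower `(0,1,4)`) and all non-dyadic `n` are new.
[folklore] -/
theorem card_posType_le_rank_gap (n : ℕ) (hn : 1 ≤ n) (hA : A.PosSemidef) (hJ : J.IsSymm) (hB : B.PosSemidef)
    (hs : ∀ i, 0 < s i) (hinj : Function.Injective s)
    (hker : ∀ i, (A + s i • J + s i ^ (n + 1) • B) *ᵥ u i = 0)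
    (htype : ∀ i, u i ⬝ᵥ (A *ᵥ u i) < n * s i ^ (n + 1) * (u i ⬝ᵥ (B *ᵥ u i))) :
    Fintype.card I ≤ B.rank := by
  obtain ⟨N, hN, hNdiag, hNoff⟩ := Loewner.exists_certificate_gap (I := I) n hn s hs hinj
  exact card_posType_le_rank_of_certificate A J B n s u hA hJ hB hs hinj hker htype N hN hNdiag hNoff

end TwoGaps

end TwoSidedThree

end Summit.ValiantsHypothesis.ValiantsHypothesis.Theorems.KPlusLogSqLaw.TowerGraft
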